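import Mathlib
import Literature.Combinatorics.Additive.TripleProductProperty

/-!
# Ideator 2 sketch — crux `LevelGradedCohnUmans.LevelTwoBeatsCubes` (stmt-MatrixMultiplication-7612)

Statements only (they must elaborate; proofs are not this seat's job).  Companion of
`IDEATOR2_CENSUS.md`.  Nothing here is a route item; the namespace is a scratch namespace.

* `TwoTokenSeparated` / `TokenSeparated k` — the separation conjunct of the crux / of
  `SnLevelDesigns`, verbatim.
* §1 `unitConfig_packing_N1`, `unitConfig_packing_N2` — the graded Neumann inequalities in their
  ABSTRACT form: any finite-dimensional algebra `A`, three families of units, separation by linear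
  functionals on `A`.  No group, no bi-invariance hypothesis to discharge (it is built into "all of
  `A^*`"), and — the point — NO inversion-closure of the test space is needed for N2 (left
  translations do it).  This is the inversion-free form of the Transfer `GradedNeumann(G,J)` of the
  card `graded-neumann-rank` (same lever; recorded here only as a sharpening for the lead).
* §2 `cube_obstruction` (level 2, toggles distributed one per slot) and `cube_obstruction_Y`
  (level k, all k+1 toggles in the Y slot) — the NEW necessary condition found by this seat:
  separated triples contain no "disjoint-support cube" through a target.  `cube_obstruction` is
  PROVED sorry-free in the companion file `CubeObstruction.lean` (lean check rc 0, axioms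
  propext/Classical.choice/Quot.sound); it is kept as a statement here only to avoid a duplicate
  declaration.  Candidate `Cruxes/LevelTwoBeatsCubes/Negative/` lemma for the disprover; pruning
  rule for level ≥ 7 searches.
* §3 `universal_host_iff` — J₂-universal subgroups: if the 2-token tests restricted to `H` are all
  functions on `H`, then inside `H` 2-token separation is exactly the tree's TPP.
-/

open scoped BigOperators

namespace Summit.MatrixMultiplication.MatrixMultiplication.Cruxes.LevelTwoBeatsCubes.Ideator2

/-- 2-token separation: the first conjunct of `LevelTwoBeatsCubes`, verbatim. -/
def TwoTokenSeparated {n : ℕ} (X Y Z : Finset (Equiv.Perm (Fin n))) : Prop :=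
  ∀ x₀ ∈ X, ∀ z₀ ∈ Z, ∃ c : (Fin 2 → Fin n) → (Fin 2 → Fin n) → ℂ,
    ∀ x ∈ X, ∀ y ∈ Y, ∀ y' ∈ Y, ∀ z ∈ Z,
      (∑ p : Fin 2 → Fin n, c p (⇑(x⁻¹ * y * y'⁻¹ * z) ∘ p)) =
        if x = x₀ ∧ y = y' ∧ z = z₀ then 1 else 0

/-- `k`-token separation: the separation conjunct of `SnLevelDesigns` / `TokenWall`, verbatim. -/
def TokenSeparated {n : ℕ} (k : ℕ) (X Y Z : Finset (Equiv.Perm (Fin n))) : Prop :=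
  ∀ x₀ ∈ X, ∀ z₀ ∈ Z, ∃ c : (Fin k → Fin n) → (Fin k → Fin n) → ℂ,
    ∀ x ∈ X, ∀ y ∈ Y, ∀ y' ∈ Y, ∀ z ∈ Z,
      (∑ p : Fin k → Fin n, c p (⇑(x⁻¹ * y * y'⁻¹ * z) ∘ p)) =
        if x = x₀ ∧ y = y' ∧ z = z₀ then 1 else 0

/-- The two predicates agree at `k = 2` (definitional). -/
theorem twoTokenSeparated_iff {n : ℕ} (X Y Z : Finset (Equiv.Perm (Fin n))) :
    TwoTokenSeparated X Y Z ↔ TokenSeparated 2 X Y Z := Iff.rfl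

/-! ## §1  Abstract unit-configuration packing (graded Neumann N1/N2, inversion-free) -/

/-- **N1, abstract form.**  In a finite-dimensional `ℂ`-algebra `A`, let `a, b, c` be families of
units indexed by finite types and suppose every "target" `(x₀, z₀)` is separated by a linear
functional: `f (a x)⁻¹ (b y) (b y')⁻¹ (c z) = [x = x₀ ∧ y = y' ∧ z = z₀]`.  Then
`|X| (|Y| + |Z| - 1) ≤ dim A`.  Proof (5 lines, right translations only): fix `y₁, z₁`; the family
`(a x)⁻¹ (b y) (b y₁)⁻¹ (c z₁)` (`x, y`) together with the targets `(a x)⁻¹ (c z)` (`x`, `z ≠ z₁`)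
is linearly independent — the separators kill the first family off `y = y₁` and are dual to the
targets, and `g ↦ f_{x₀ z₁} (g · (c z₁)⁻¹ (b y₁) (b y₂)⁻¹ (c z₁))` is dual to the first family. -/
theorem unitConfig_packing_N1 {A : Type*} [Ring A] [Algebra ℂ A] [Module.Finite ℂ A]
    {ιX ιY ιZ : Type*} [Fintype ιX] [Fintype ιY] [Fintype ιZ]
    [DecidableEq ιX] [DecidableEq ιY] [DecidableEq ιZ] [Nonempty ιY] [Nonempty ιZ]
    (a : ιX → Aˣ) (b : ιY → Aˣ) (c : ιZ → Aˣ)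
    (hsep : ∀ x₀ z₀, ∃ f : Module.Dual ℂ A, ∀ x y y' z,
      f ((((a x)⁻¹ : Aˣ) : A) * (b y : A) * (((b y')⁻¹ : Aˣ) : A) * (c z : A)) =
        if x = x₀ ∧ y = y' ∧ z = z₀ then 1 else 0) :
    Fintype.card ιX * (Fintype.card ιY + Fintype.card ιZ - 1) ≤ Module.finrank ℂ A := by
  sorry

/-- **N2, abstract form** (left translations; no anti-automorphism / inversion-closure used):
`|Z| (|X| + |Y| - 1) ≤ dim A`.  Proof: fix `x₁, y₁`; the family `(a x₁)⁻¹ (b y₁) (b y')⁻¹ (c z)`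
(`y', z`) together with the targets (`x ≠ x₁`, `z`) is independent — separators are dual to the
targets and vanish on the family off `y' = y₁`; `g ↦ f_{x₁ z₀} ((a x₁)⁻¹ (b y₂) (b y₁)⁻¹ (a x₁) · g)`
is dual to the family. -/
theorem unitConfig_packing_N2 {A : Type*} [Ring A] [Algebra ℂ A] [Module.Finite ℂ A]
    {ιX ιY ιZ : Type*} [Fintype ιX] [Fintype ιY] [Fintype ιZ]
    [DecidableEq ιX] [DecidableEq ιY] [DecidableEq ιZ] [Nonempty ιX] [Nonempty ιY]
    (a : ιX → Aˣ) (b : ιY → Aˣ) (c : ιZ → Aˣ)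
    (hsep : ∀ x₀ z₀, ∃ f : Module.Dual ℂ A, ∀ x y y' z,
      f ((((a x)⁻¹ : Aˣ) : A) * (b y : A) * (((b y')⁻¹ : Aˣ) : A) * (c z : A)) =
        if x = x₀ ∧ y = y' ∧ z = z₀ then 1 else 0) :
    Fintype.card ιZ * (Fintype.card ιX + Fintype.card ιY - 1) ≤ Module.finrank ℂ A := by
  sorry

/-! ## §2  The disjoint-support cube obstruction (new necessary condition) -/

/-- **Cube obstruction, level 2, one toggle per slot.**  If `(X, Y, Z)` is 2-token separated then
for `x₀ ≠ x₁` in `X`, `y ≠ y'` in `Y`, `z₀ ≠ z₁` in `Z` the three "differences"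
`σ₁ = x₀ x₁⁻¹`, `σ₂ = y y'⁻¹`, `σ₃ = z₁ z₀⁻¹` are NOT pairwise disjoint.
Proof: the eight quadruples `(x_a, y, y'_b, z_c)` (`a b c ∈ {0,1}`, `x_0 = x₀`, `x_1 = x₁`,
`y'_0 = y`, `y'_1 = y'`, `z_0 = z₀`, `z_1 = z₁`) have products `x₀⁻¹ σ₁^a σ₂^b σ₃^c z₀`, on which the
separator of the target `(x₀, z₀)` takes the values `[a = b = c = 0]`, alternating sum `1`; but for
each `p : Fin 2 → Fin n` the tuple `(x₀⁻¹ σ₁^a σ₂^b σ₃^c z₀) ∘ p` depends on at most two of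
`a, b, c` (each point is moved by at most one `σ_i`), so every 2-token test has alternating sum `0`
over the cube.  PROVED in `CubeObstruction.lean` (same statement, sorry-free). -/
theorem cube_obstruction {n : ℕ} {X Y Z : Finset (Equiv.Perm (Fin n))}
    (hsep : TwoTokenSeparated X Y Z)
    {x₀ x₁ y y' z₀ z₁ : Equiv.Perm (Fin n)}
    (hx₀ : x₀ ∈ X) (hx₁ : x₁ ∈ X) (hy : y ∈ Y) (hy' : y' ∈ Y) (hz₀ : z₀ ∈ Z) (hz₁ : z₁ ∈ Z)
    (h₁ : x₀ ≠ x₁) (h₂ : y ≠ y') (h₃ : z₀ ≠ z₁)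
    (d₁₂ : Equiv.Perm.Disjoint (x₀ * x₁⁻¹) (y * y'⁻¹))
    (d₁₃ : Equiv.Perm.Disjoint (x₀ * x₁⁻¹) (z₁ * z₀⁻¹))
    (d₂₃ : Equiv.Perm.Disjoint (y * y'⁻¹) (z₁ * z₀⁻¹)) : False := by
  sorry

/-- **Cube obstruction, level `k`, all toggles in the `Y` slot.**  If `Y` contains a left cube
`{σ_S y₀ : S ⊆ [k+1]}` of `k+1` pairwise disjoint non-identity permutations and `X, Z` are
non-empty, then `(X, Y, Z)` is not `k`-token separated (quadruples `(x₀, σ_S y₀, y₀, z₀)` have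
products `x₀⁻¹ σ_S z₀` and separator values `[S = ∅]`; a `k`-token test sees at most `k` of the
`k+1` toggles).  The list product is over `S` sorted increasingly; disjoint permutations commute, so
the order is immaterial. -/
theorem cube_obstruction_Y {n k : ℕ} {X Y Z : Finset (Equiv.Perm (Fin n))}
    (hsep : TokenSeparated k X Y Z) (hX : X.Nonempty) (hZ : Z.Nonempty)
    (σ : Fin (k + 1) → Equiv.Perm (Fin n)) (hσ : ∀ i, σ i ≠ 1)
    (hdisj : ∀ i j, i ≠ j → Equiv.Perm.Disjoint (σ i) (σ j))
    (y₀ : Equiv.Perm (Fin n))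
    (hcube : ∀ S : Finset (Fin (k + 1)), ((S.sort (· ≤ ·)).map σ).prod * y₀ ∈ Y) : False := by
  sorry

/-! ## §3  J₂-universal hosts -/

/-- **Universal hosts.**  If `H ≤ 𝔖ₙ` is J₂-universal — every function on `H` is the restriction
of a 2-token test (equivalently: every irreducible representation of `H` occurs in the permutation
module of `H` on ordered pairs; e.g. base size ≤ 2 such as `AGL₁(q) < 𝔖_q`, or `A₅ < 𝔖₅`,
`PSL₂(q) < 𝔖_{q+1}`) — then for `X, Y, Z ⊆ H`, 2-token separation is exactly the tree's
`TripleProductProperty`.  (`←`: the product set lies in `H`, take any function on `H` equal to the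
indicator of the target and extend it as a 2-token test by universality; `→`: the route's
`SepImpliesTPP`.)  Consequence: level-2 designs inside a universal host are TPP triples of a group
that embeds in `ℂ[𝔖ₙ]/J₂^⊥`, hence `|H| ≤ dim J₂` and `|X||Y||Z| ≤ max_p (p|H| − p³ + p²)` by the
classical Neumann inequality — no graded argument needed for this subfamily. -/
theorem universal_host_iff {n : ℕ} (H : Subgroup (Equiv.Perm (Fin n)))
    (huniv : ∀ φ : Equiv.Perm (Fin n) → ℂ, ∃ c : (Fin 2 → Fin n) → (Fin 2 → Fin n) → ℂ,
      ∀ g ∈ H, (∑ p : Fin 2 → Fin n, c p (⇑g ∘ p)) = φ g)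
    (X Y Z : Finset (Equiv.Perm (Fin n)))
    (hX : ∀ x ∈ X, x ∈ H) (hY : ∀ y ∈ Y, y ∈ H) (hZ : ∀ z ∈ Z, z ∈ H) :
    TwoTokenSeparated X Y Z ↔
      Literature.Combinatorics.Additive.TripleProductProperty X Y Z := by
  sorry

end Summit.MatrixMultiplication.MatrixMultiplication.Cruxes.LevelTwoBeatsCubes.Ideator2
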